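import Summits.BirchSwinnertonDyer.BirchSwinnertonDyer.Theorems.Rank2Observatory2DescFunctionals
import Summits.BirchSwinnertonDyer.BirchSwinnertonDyer.Theorems.Rank2Observatory2DescAdmResidue
import Summits.BirchSwinnertonDyer.BirchSwinnertonDyer.Theorems.Rank2Observatory2DescLinGens
import HarnessLib

/-!
# BirchSwinnertonDyer — rank ≥ 2 observatory: the three-real-place sieve (totally real cubic fields)

HONEST FRAMING: per-curve certified theorems and census instruments; no claim on BSD in rank ≥ 2.

Generic addendum of the KERNEL-2DESC instrument (design `b2b-bsdr2-cert-3/KERNEL-2DESC.md`,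
production stage S6). When the 2-division field `K = ℚ(θ)` of `y² = F(x)` is totally real, `F` has
three real roots `e₁ < e₂ < e₃` (the images of `θ` under the three real places `ρ₁, ρ₂, ρ₃`) and the
real-sign functional of `admStd` (definite cofactor) is unavailable. Instead, at a rational point,
`F(x) = (x − e₁)(x − e₂)(x − e₃) = y² > 0` forces `x > e₁` and `sign(x − e₂) = sign(x − e₃)`; so a
pair `(T, U)` realised by a point has an even number of `ρ₁`-negative factors and equal parities of
`ρ₂`- and `ρ₃`-negative factors (`admStd3R`, soundness `admStd3R_sound`; residue form `admStd3RQ`).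
The ordering `ρ₁(θ) < ρ₂(θ) < ρ₃(θ)` is certified per curve from isolating intervals of the field
generator by `lin_lt_lin`; the middle real place comes from `exists_real_embedding_of_sign_change'`
(sign change `+ → −`).

Sorry-free; axioms `propext`, `Classical.choice`, `Quot.sound`.
[cite: Cassels1991LecturesEllipticCurves, §15; SilvermanAEC2009, Prop. X.1.4]
-/

-- single-conjunct summit: `Summit.BirchSwinnertonDyer.BirchSwinnertonDyer.…` repeats the name by design
set_option linter.dupNamespace false

noncomputable section

open scoped Classical NumberField

open Literature.NumberTheory.NumberFields Polynomial Module NumberField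

namespace Summit.BirchSwinnertonDyer.BirchSwinnertonDyer.Rank2Observatory.TwoDescCubic

section RealRoots

variable {A B C : ℤ}

/-- A real root of `F` in `(lo, hi)` from a sign change `F(lo) > 0 > F(hi)` (the middle root of a
totally real cubic). [folklore] -/
theorem exists_real_root_of_sign_change' {lo hi : ℚ} (hlt : lo < hi)
    (hlo : 0 < lo ^ 3 + A * lo ^ 2 + B * lo + C) (hhi : hi ^ 3 + A * hi ^ 2 + B * hi + C < 0) :
    ∃ e : ℝ, (lo : ℝ) < e ∧ e < hi ∧ e ^ 3 + A * e ^ 2 + B * e + C = 0 := by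
  let f : ℝ → ℝ := fun r => -(r ^ 3 + A * r ^ 2 + B * r + C)
  have hf : ContinuousOn f (Set.Icc (lo : ℝ) hi) := by fun_prop
  have hlo' : f lo < 0 := by
    have h : (0 : ℝ) < ((lo ^ 3 + A * lo ^ 2 + B * lo + C : ℚ) : ℝ) := by exact_mod_cast hlo
    push_cast at h
    simp only [f]
    linarith
  have hhi' : 0 < f hi := by
    have h : ((hi ^ 3 + A * hi ^ 2 + B * hi + C : ℚ) : ℝ) < 0 := by exact_mod_cast hhi
    push_cast at h
    simp only [f]
    linarith
  have hle : (lo : ℝ) ≤ hi := by exact_mod_cast hlt.le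
  obtain ⟨r, ⟨hr0, hr1⟩, hr⟩ := intermediate_value_Ioo hle hf ⟨hlo', hhi'⟩
  refine ⟨r, hr0, hr1, ?_⟩
  simp only [f] at hr
  linarith

variable {K : Type*} [Field K] [NumberField K] {θ : K}

/-- **A real embedding `ρ` with `lo < ρ(θ) < hi`** from a sign change `F(lo) > 0 > F(hi)`.
[folklore] -/
theorem exists_real_embedding_of_sign_change'
    (hirr : Irreducible (MonicCubic.polyQ A B C)) (hθ : aeval θ (MonicCubic.poly A B C) = 0)
    (h3 : finrank ℚ K = 3) {lo hi : ℚ} (hlt : lo < hi)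
    (hlo : 0 < lo ^ 3 + A * lo ^ 2 + B * lo + C) (hhi : hi ^ 3 + A * hi ^ 2 + B * hi + C < 0) :
    ∃ ρ : K →+* ℝ, (lo : ℝ) < ρ θ ∧ ρ θ < hi := by
  obtain ⟨r, hr0, hr1, hr⟩ := exists_real_root_of_sign_change' hlt hlo hhi
  set pb := MonicCubic.pb hirr hθ h3 with hpb
  have hgen : pb.gen = θ := MonicCubic.pb_gen hirr hθ h3
  have hy : aeval r (minpoly ℚ pb.gen) = 0 := by
    rw [hgen, MonicCubic.minpoly_rat_eq hirr hθ, MonicCubic.polyQ_eq]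
    simp only [map_add, map_mul, map_pow, aeval_X, aeval_C, eq_ratCast]
    push_cast
    linear_combination hr
  have hθr : (pb.lift r hy).toRingHom θ = r := by
    change pb.lift r hy θ = r
    conv_lhs => rw [← hgen]
    exact PowerBasis.lift_gen pb r hy
  exact ⟨(pb.lift r hy).toRingHom, by rw [hθr]; exact hr0, by rw [hθr]; exact hr1⟩

/-- **Factorisation over three distinct real roots**: `F(t) = (t − e₁)(t − e₂)(t − e₃)`.
[folklore] -/
theorem cubic_eq_prod_of_roots {e₁ e₂ e₃ : ℝ} (h₁ : e₁ ^ 3 + A * e₁ ^ 2 + B * e₁ + C = 0)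
    (h₂ : e₂ ^ 3 + A * e₂ ^ 2 + B * e₂ + C = 0) (h₃ : e₃ ^ 3 + A * e₃ ^ 2 + B * e₃ + C = 0)
    (h12 : e₁ ≠ e₂) (h13 : e₁ ≠ e₃) (h23 : e₂ ≠ e₃) (t : ℝ) :
    t ^ 3 + A * t ^ 2 + B * t + C = (t - e₁) * (t - e₂) * (t - e₃) := by
  have hq2 : e₂ ^ 2 + (e₁ + A) * e₂ + (e₁ ^ 2 + A * e₁ + B) = 0 := by
    have h : (e₂ - e₁) * (e₂ ^ 2 + (e₁ + A) * e₂ + (e₁ ^ 2 + A * e₁ + B)) = 0 := by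
      linear_combination h₂ - h₁
    rcases mul_eq_zero.mp h with h | h
    · exact absurd (sub_eq_zero.mp h).symm h12
    · exact h
  have hq3 : e₃ ^ 2 + (e₁ + A) * e₃ + (e₁ ^ 2 + A * e₁ + B) = 0 := by
    have h : (e₃ - e₁) * (e₃ ^ 2 + (e₁ + A) * e₃ + (e₁ ^ 2 + A * e₁ + B)) = 0 := by
      linear_combination h₃ - h₁
    rcases mul_eq_zero.mp h with h | h
    · exact absurd (sub_eq_zero.mp h).symm h13
    · exact h
  have hsum : e₁ + e₂ + e₃ = -A := by
    have h : (e₂ - e₃) * (e₂ + e₃ + e₁ + A) = 0 := by linear_combination hq2 - hq3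
    rcases mul_eq_zero.mp h with h | h
    · exact absurd (sub_eq_zero.mp h) h23
    · linarith
  have hprod : e₂ * e₃ = e₁ ^ 2 + A * e₁ + B := by linear_combination e₂ * hsum - hq2
  linear_combination h₁ + ((t - e₁) * t) * hsum - (t - e₁) * hprod

/-- **Signs at a point**: with `e₁ < e₂ < e₃` and `(x − e₁)(x − e₂)(x − e₃) > 0`, `x > e₁` and
`x − e₂`, `x − e₃` have the same sign. [cite: Cassels1991LecturesEllipticCurves, §15] -/
theorem signs_of_three_roots {e₁ e₂ e₃ x : ℝ} (h12 : e₁ < e₂) (h23 : e₂ < e₃)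
    (hF : 0 < (x - e₁) * (x - e₂) * (x - e₃)) : 0 < x - e₁ ∧ (x - e₂ < 0 ↔ x - e₃ < 0) := by
  have h1 : 0 < x - e₁ := by
    by_contra h
    push Not at h
    have ha : x - e₂ < 0 := by linarith
    have hb : x - e₃ < 0 := by linarith
    have hab : 0 < (x - e₂) * (x - e₃) := mul_pos_of_neg_of_neg ha hb
    nlinarith
  refine ⟨h1, ?_⟩
  have hbc : 0 < (x - e₂) * (x - e₃) := by
    rw [mul_assoc] at hF
    exact (mul_pos_iff_of_pos_left h1).mp hF
  rw [mul_pos_iff] at hbc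
  rcases hbc with ⟨ha, hb⟩ | ⟨ha, hb⟩
  · exact iff_of_false (not_lt.mpr ha.le) (not_lt.mpr hb.le)
  · exact iff_of_true ha hb

omit [NumberField K] in
/-- Sign transfer through a square: `ξ·z ∈ K²`, `ρ(ξ), ρ(z) ≠ 0` ⇒ `sign ρ(z) = sign ρ(ξ)`. [folklore] -/
theorem neg_iff_of_isSquare_mul (ρ : K →+* ℝ) {ξ z : K} (hξ : ρ ξ ≠ 0) (hz : z ≠ 0)
    (hsq : IsSquare (ξ * z)) : (ρ z < 0 ↔ ρ ξ < 0) := by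
  obtain ⟨r, hr⟩ := hsq
  have hw : ρ ξ * ρ z = ρ r * ρ r := by rw [← map_mul, hr, map_mul]
  have hρz : ρ z ≠ 0 := (map_ne_zero ρ).mpr hz
  have hnn : 0 ≤ ρ ξ * ρ z := by rw [hw]; exact mul_self_nonneg _
  constructor
  · intro h
    by_contra h'
    have hp : 0 < ρ ξ := lt_of_le_of_ne (not_lt.mp h') (Ne.symm hξ)
    nlinarith
  · intro h
    by_contra h'
    have hp : 0 < ρ z := lt_of_le_of_ne (not_lt.mp h') (Ne.symm hρz)
    nlinarith

/-- For non-zero reals with `a < 0 ↔ b < 0`, also `0 < a ↔ 0 < b`. [folklore] -/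
theorem pos_iff_pos_of_neg_iff_neg {a b : ℝ} (ha : a ≠ 0) (hb : b ≠ 0) (h : a < 0 ↔ b < 0) :
    (0 < a ↔ 0 < b) := by
  constructor
  · intro hpa
    rcases lt_or_gt_of_ne hb with hb' | hb'
    · exact absurd (h.mpr hb') (not_lt.mpr hpa.le)
    · exact hb'
  · intro hpb
    rcases lt_or_gt_of_ne ha with ha' | ha'
    · exact absurd (h.mp ha') (not_lt.mpr hpb.le)
    · exact ha'

end RealRoots

section Intervals

/-- Lower interval bound: `c₀ + min(c₁lo, c₁hi) + min(c₂lo², c₂hi²) ≤ c₀ + c₁x + c₂x²` on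
`lo < x < hi` (`0 ≤ lo`). [folklore] -/
theorem lower_le_quad {lo hi : ℚ} {x : ℝ} (h0 : 0 ≤ lo) (hlo : (lo : ℝ) < x) (hhi : x < hi)
    (c₀ c₁ c₂ : ℤ) :
    (((c₀ : ℚ) + min (c₁ * lo) (c₁ * hi) + min (c₂ * lo ^ 2) (c₂ * hi ^ 2) : ℚ) : ℝ) ≤
      (c₀ : ℝ) + c₁ * x + c₂ * x ^ 2 := by
  have hx0 : 0 ≤ x := le_trans (by exact_mod_cast h0) hlo.le
  have h1 : ((min (c₁ * lo) (c₁ * hi) : ℚ) : ℝ) ≤ c₁ * x := by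
    push_cast
    rcases le_total 0 (c₁ : ℝ) with hc1 | hc1
    · exact (min_le_left _ _).trans (by nlinarith)
    · exact (min_le_right _ _).trans (by nlinarith)
  have h2 : ((min (c₂ * lo ^ 2) (c₂ * hi ^ 2) : ℚ) : ℝ) ≤ c₂ * x ^ 2 := by
    push_cast
    have hlo0 : (0 : ℝ) ≤ lo := by exact_mod_cast h0
    have hlo2 : (lo : ℝ) ^ 2 ≤ x ^ 2 := pow_le_pow_left₀ hlo0 hlo.le 2
    have hhi2 : x ^ 2 ≤ (hi : ℝ) ^ 2 := pow_le_pow_left₀ hx0 hhi.le 2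
    rcases le_total 0 (c₂ : ℝ) with hc2 | hc2
    · exact (min_le_left _ _).trans (by nlinarith)
    · exact (min_le_right _ _).trans (by nlinarith)
  push_cast at h1 h2 ⊢
  linarith

/-- Upper interval bound: `c₀ + c₁x + c₂x² ≤ c₀ + max(c₁lo, c₁hi) + max(c₂lo², c₂hi²)` on
`lo < x < hi` (`0 ≤ lo`). [folklore] -/
theorem quad_le_upper {lo hi : ℚ} {x : ℝ} (h0 : 0 ≤ lo) (hlo : (lo : ℝ) < x) (hhi : x < hi)
    (c₀ c₁ c₂ : ℤ) :
    (c₀ : ℝ) + c₁ * x + c₂ * x ^ 2 ≤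
      (((c₀ : ℚ) + max (c₁ * lo) (c₁ * hi) + max (c₂ * lo ^ 2) (c₂ * hi ^ 2) : ℚ) : ℝ) := by
  have hx0 : 0 ≤ x := le_trans (by exact_mod_cast h0) hlo.le
  have h1 : c₁ * x ≤ ((max (c₁ * lo) (c₁ * hi) : ℚ) : ℝ) := by
    push_cast
    rcases le_total 0 (c₁ : ℝ) with hc1 | hc1
    · exact le_trans (by nlinarith) (le_max_right _ _)
    · exact le_trans (by nlinarith) (le_max_left _ _)
  have h2 : c₂ * x ^ 2 ≤ ((max (c₂ * lo ^ 2) (c₂ * hi ^ 2) : ℚ) : ℝ) := by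
    push_cast
    have hlo0 : (0 : ℝ) ≤ lo := by exact_mod_cast h0
    have hlo2 : (lo : ℝ) ^ 2 ≤ x ^ 2 := pow_le_pow_left₀ hlo0 hlo.le 2
    have hhi2 : x ^ 2 ≤ (hi : ℝ) ^ 2 := pow_le_pow_left₀ hx0 hhi.le 2
    rcases le_total 0 (c₂ : ℝ) with hc2 | hc2
    · exact le_trans (by nlinarith) (le_max_right _ _)
    · exact le_trans (by nlinarith) (le_max_left _ _)
  push_cast at h1 h2 ⊢
  linarith

variable {K : Type*} [Field K] [NumberField K] {a b c : ℤ} {θ : K}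

/-- **Ordering two real places on an element** `c₀ + c₁θ + c₂θ²` from isolating intervals of `θ`:
upper bound at `ρ` below lower bound at `ρ'`. [folklore] -/
theorem lin_lt_lin (hθ : aeval θ (MonicCubic.poly a b c) = 0) (ρ ρ' : K →+* ℝ)
    {lo hi lo' hi' : ℚ} (h0 : 0 ≤ lo) (hlo : ((lo : ℚ) : ℝ) < ρ θ) (hhi : ρ θ < ((hi : ℚ) : ℝ))
    (h0' : 0 ≤ lo') (hlo' : ((lo' : ℚ) : ℝ) < ρ' θ) (hhi' : ρ' θ < ((hi' : ℚ) : ℝ)) (c₀ c₁ c₂ : ℤ)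
    (hc : (c₀ : ℚ) + max (c₁ * lo) (c₁ * hi) + max (c₂ * lo ^ 2) (c₂ * hi ^ 2) <
      (c₀ : ℚ) + min (c₁ * lo') (c₁ * hi') + min (c₂ * lo' ^ 2) (c₂ * hi' ^ 2)) :
    ρ ((lin hθ c₀ c₁ c₂ : 𝓞 K) : K) < ρ' ((lin hθ c₀ c₁ c₂ : 𝓞 K) : K) := by
  have h1 := quad_le_upper h0 hlo hhi c₀ c₁ c₂
  have h2 := lower_le_quad h0' hlo' hhi' c₀ c₁ c₂
  have hc' : (((c₀ : ℚ) + max (c₁ * lo) (c₁ * hi) + max (c₂ * lo ^ 2) (c₂ * hi ^ 2) : ℚ) : ℝ) <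
      (((c₀ : ℚ) + min (c₁ * lo') (c₁ * hi') + min (c₂ * lo' ^ 2) (c₂ * hi' ^ 2) : ℚ) : ℝ) := by
    exact_mod_cast hc
  rw [lin_coe]
  simp only [map_add, map_mul, map_pow, map_intCast]
  linarith

end Intervals

section Sieve

variable {m s : ℕ}

/-- **The three-real-place sieve** on a pair `(T, U)`: the product of the norms is a square, the
number of factors negative at the place of the smallest conjugate of `θ` is even, and the numbers
of factors negative at the two other places have the same parity. Sign bits `true` = negative;
`suₖ`/`sgₖ` refer to the place `ρₖ` with `ρ₁(θ) < ρ₂(θ) < ρ₃(θ)`. Computable (`decide`).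
[cite: Cassels1991LecturesEllipticCurves, §15] -/
def admStd3R (Nu : Fin m → ℤ) (Ng : Fin s → ℤ) (su₁ su₂ su₃ : Fin m → Bool)
    (sg₁ sg₂ sg₃ : Fin s → Bool) (T : Finset (Fin m)) (U : Finset (Fin s)) : Bool :=
  decide (IsSquare ((∏ i ∈ T, Nu i) * ∏ j ∈ U, Ng j)) &&
    (decide (Even ((T.filter fun i => su₁ i = true).card + (U.filter fun j => sg₁ j = true).card)) &&
      decide (Even ((T.filter fun i => su₂ i = true).card + (U.filter fun j => sg₂ j = true).card +
        ((T.filter fun i => su₃ i = true).card + (U.filter fun j => sg₃ j = true).card))))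

/-- The empty pair passes the three-real-place sieve. [folklore] -/
theorem admStd3R_empty (Nu : Fin m → ℤ) (Ng : Fin s → ℤ) (su₁ su₂ su₃ : Fin m → Bool)
    (sg₁ sg₂ sg₃ : Fin s → Bool) : admStd3R Nu Ng su₁ su₂ su₃ sg₁ sg₂ sg₃ ∅ ∅ = true := by
  simp [admStd3R]

/-- **Residue form** of the three-real-place sieve: square-residue test modulo every `q ∈ Q` on the
product of the norms instead of the exact square test. [folklore] -/
def admStd3RQ (Q : List ℕ) (Nu : Fin m → ℤ) (Ng : Fin s → ℤ) (su₁ su₂ su₃ : Fin m → Bool)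
    (sg₁ sg₂ sg₃ : Fin s → Bool) (T : Finset (Fin m)) (U : Finset (Fin s)) : Bool :=
  (Q.all fun q => sqResidue q ((∏ i ∈ T, Nu i) * ∏ j ∈ U, Ng j)) &&
    (decide (Even ((T.filter fun i => su₁ i = true).card + (U.filter fun j => sg₁ j = true).card)) &&
      decide (Even ((T.filter fun i => su₂ i = true).card + (U.filter fun j => sg₂ j = true).card +
        ((T.filter fun i => su₃ i = true).card + (U.filter fun j => sg₃ j = true).card))))

/-- **Transfer of soundness**: `admStd3R = true` gives `admStd3RQ Q = true` (all moduli positive).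
[folklore] -/
theorem admStd3RQ_of_admStd3R {Q : List ℕ} (hQ : ∀ q ∈ Q, 0 < q) {Nu : Fin m → ℤ} {Ng : Fin s → ℤ}
    {su₁ su₂ su₃ : Fin m → Bool} {sg₁ sg₂ sg₃ : Fin s → Bool} {T : Finset (Fin m)}
    {U : Finset (Fin s)} (h : admStd3R Nu Ng su₁ su₂ su₃ sg₁ sg₂ sg₃ T U = true) :
    admStd3RQ Q Nu Ng su₁ su₂ su₃ sg₁ sg₂ sg₃ T U = true := by
  rw [admStd3R, Bool.and_eq_true, decide_eq_true_eq] at h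
  rw [admStd3RQ, Bool.and_eq_true, List.all_eq_true]
  exact ⟨fun q hq => sqResidue_of_isSquare (hQ q hq) h.1, h.2⟩

/-- `admStd3RQ Q` admits the trivial pair. [folklore] -/
theorem admStd3RQ_empty (Q : List ℕ) (hQ : ∀ q ∈ Q, 0 < q) (Nu : Fin m → ℤ) (Ng : Fin s → ℤ)
    (su₁ su₂ su₃ : Fin m → Bool) (sg₁ sg₂ sg₃ : Fin s → Bool) :
    admStd3RQ Q Nu Ng su₁ su₂ su₃ sg₁ sg₂ sg₃ ∅ ∅ = true :=
  admStd3RQ_of_admStd3R hQ (admStd3R_empty Nu Ng su₁ su₂ su₃ sg₁ sg₂ sg₃)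

variable {K : Type*} [Field K] [NumberField K] {A B C : ℤ} {θ : K}

omit [NumberField K] in
/-- **Parity ↔ sign** at a real place: with sign bits `true` = negative, the number of negative
factors of `∏_T w · ∏_U g` is even iff the place is positive on the product. [folklore] -/
theorem even_card_iff_pos (ρ : K →+* ℝ) {w : Fin m → K} {g : Fin s → K} (hw0 : ∀ i, w i ≠ 0)
    (hg0 : ∀ j, g j ≠ 0) {su : Fin m → Bool} {sg : Fin s → Bool}
    (hsu : ∀ i, su i = true ↔ ρ (w i) < 0) (hsg : ∀ j, sg j = true ↔ ρ (g j) < 0)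
    (T : Finset (Fin m)) (U : Finset (Fin s)) :
    Even ((T.filter fun i => su i = true).card + (U.filter fun j => sg j = true).card) ↔
      0 < ρ ((∏ i ∈ T, w i) * ∏ j ∈ U, g j) := by
  rw [map_mul, map_prod, map_prod]
  have h1 := prod_pos_iff_even_card_neg T (fun i => ρ (w i)) (fun i => (map_ne_zero ρ).mpr (hw0 i))
  have h2 := prod_pos_iff_even_card_neg U (fun j => ρ (g j)) (fun j => (map_ne_zero ρ).mpr (hg0 j))
  have hfT : T.filter (fun i => su i = true) = T.filter (fun i => ρ (w i) < 0) :=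
    Finset.filter_congr (fun i _ => hsu i)
  have hfU : U.filter (fun j => sg j = true) = U.filter (fun j => ρ (g j) < 0) :=
    Finset.filter_congr (fun j _ => hsg j)
  rw [hfT, hfU, Nat.even_add, ← h1, ← h2]
  have ha0 : ∏ i ∈ T, ρ (w i) ≠ 0 :=
    Finset.prod_ne_zero_iff.mpr fun i _ => (map_ne_zero ρ).mpr (hw0 i)
  have hb0 : ∏ j ∈ U, ρ (g j) ≠ 0 :=
    Finset.prod_ne_zero_iff.mpr fun j _ => (map_ne_zero ρ).mpr (hg0 j)
  constructor
  · intro h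
    by_cases ha : 0 < ∏ i ∈ T, ρ (w i)
    · exact mul_pos ha (h.mp ha)
    · have ha' : ∏ i ∈ T, ρ (w i) < 0 := lt_of_le_of_ne (not_lt.mp ha) ha0
      have hb' : ∏ j ∈ U, ρ (g j) < 0 := by
        rcases lt_or_gt_of_ne hb0 with hb | hb
        · exact hb
        · exact absurd (h.mpr hb) ha
      exact mul_pos_of_neg_of_neg ha' hb'
  · intro h
    rw [mul_pos_iff] at h
    rcases h with ⟨ha, hb⟩ | ⟨ha, hb⟩
    · exact iff_of_true ha hb
    · exact iff_of_false (not_lt.mpr ha.le) (not_lt.mpr hb.le)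

/-- **Soundness of the three-real-place sieve** (= hypothesis `hadm` of
`mordellWeilRank_le_of_coverSet` for a totally real 2-division field): with certified norms and
sign bits at three real places ordered by `ρ₁(θ) < ρ₂(θ) < ρ₃(θ)`, every pair `(T, U)` realised by
a rational point — `(x − θ)·∏_T w·∏_U g ∈ K²` — passes `admStd3R`.
[cite: Cassels1991LecturesEllipticCurves, §15] -/
theorem admStd3R_sound (hirr : Irreducible (MonicCubic.polyQ A B C))
    (hθ : aeval θ (MonicCubic.poly A B C) = 0) (h3 : finrank ℚ K = 3) (ρ₁ ρ₂ ρ₃ : K →+* ℝ)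
    (h12 : ρ₁ θ < ρ₂ θ) (h23 : ρ₂ θ < ρ₃ θ)
    {w : Fin m → K} {g : Fin s → K} (hw0 : ∀ i, w i ≠ 0) (hg0 : ∀ j, g j ≠ 0)
    {Nu : Fin m → ℤ} (hNu : ∀ i, Algebra.norm ℚ (w i) = Nu i)
    {Ng : Fin s → ℤ} (hNg : ∀ j, Algebra.norm ℚ (g j) = Ng j)
    {su₁ su₂ su₃ : Fin m → Bool} {sg₁ sg₂ sg₃ : Fin s → Bool}
    (hsu₁ : ∀ i, su₁ i = true ↔ ρ₁ (w i) < 0) (hsu₂ : ∀ i, su₂ i = true ↔ ρ₂ (w i) < 0)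
    (hsu₃ : ∀ i, su₃ i = true ↔ ρ₃ (w i) < 0) (hsg₁ : ∀ j, sg₁ j = true ↔ ρ₁ (g j) < 0)
    (hsg₂ : ∀ j, sg₂ j = true ↔ ρ₂ (g j) < 0) (hsg₃ : ∀ j, sg₃ j = true ↔ ρ₃ (g j) < 0)
    (x y : ℚ) (hE : y ^ 2 = x ^ 3 + A * x ^ 2 + B * x + C) (T : Finset (Fin m)) (U : Finset (Fin s))
    (hsq : IsSquare ((algebraMap ℚ K x - θ) * (∏ i ∈ T, w i) * ∏ j ∈ U, g j)) :
    admStd3R Nu Ng su₁ su₂ su₃ sg₁ sg₂ sg₃ T U = true := by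
  set z := (∏ i ∈ T, w i) * ∏ j ∈ U, g j with hz
  have hsq' : IsSquare ((algebraMap ℚ K x - θ) * z) := by rwa [hz, ← mul_assoc]
  have hz0 : z ≠ 0 := mul_ne_zero (Finset.prod_ne_zero_iff.mpr fun i _ => hw0 i)
    (Finset.prod_ne_zero_iff.mpr fun j _ => hg0 j)
  rw [admStd3R, Bool.and_eq_true, Bool.and_eq_true, decide_eq_true_eq, decide_eq_true_eq,
    decide_eq_true_eq]
  -- the real picture: `F(x) = (x − e₁)(x − e₂)(x − e₃) = y² > 0`
  have hy := y_ne_zero_of_irreducible hirr hE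
  have hFx : (0 : ℝ) < ((x : ℝ) - ρ₁ θ) * ((x : ℝ) - ρ₂ θ) * ((x : ℝ) - ρ₃ θ) := by
    rw [← cubic_eq_prod_of_roots (rho_theta_root ρ₁ hθ) (rho_theta_root ρ₂ hθ)
      (rho_theta_root ρ₃ hθ) (ne_of_lt h12) (ne_of_lt (h12.trans h23)) (ne_of_lt h23)]
    have hE' : ((y : ℝ)) ^ 2 = (x : ℝ) ^ 3 + A * (x : ℝ) ^ 2 + B * x + C := by exact_mod_cast hE
    rw [← hE']
    have hy' : (y : ℝ) ≠ 0 := by exact_mod_cast hy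
    positivity
  obtain ⟨hx1, hx23⟩ := signs_of_three_roots h12 h23 hFx
  have hξ : ∀ ρ : K →+* ℝ, ρ (algebraMap ℚ K x - θ) = (x : ℝ) - ρ θ := fun ρ => by
    have hx : ρ (algebraMap ℚ K x) = (x : ℝ) := eq_ratCast (ρ.comp (algebraMap ℚ K)) x
    rw [map_sub, hx]
  have hx2 : (x : ℝ) - ρ₂ θ ≠ 0 := fun h => by
    rw [h, mul_zero, zero_mul] at hFx
    exact lt_irrefl _ hFx
  have hx3 : (x : ℝ) - ρ₃ θ ≠ 0 := fun h => by
    rw [h, mul_zero] at hFx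
    exact lt_irrefl _ hFx
  have hρ1z : 0 < ρ₁ z := rho_pos_of_isSquare_mul ρ₁ (by rw [hξ]; exact hx1) hz0 hsq'
  have h2 := neg_iff_of_isSquare_mul ρ₂ (by rw [hξ]; exact hx2) hz0 hsq'
  have h3' := neg_iff_of_isSquare_mul ρ₃ (by rw [hξ]; exact hx3) hz0 hsq'
  rw [hξ] at h2 h3'
  have h23z : (ρ₂ z < 0 ↔ ρ₃ z < 0) := h2.trans (hx23.trans h3'.symm)
  refine ⟨?_, ?_, ?_⟩
  · -- the norm functional
    have hN := isSquare_norm_of_isSquare_mul hirr hθ h3 hE hsq'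
    have hNz : Algebra.norm ℚ z = (((∏ i ∈ T, Nu i) * ∏ j ∈ U, Ng j : ℤ) : ℚ) := by
      rw [hz, map_mul, map_prod, map_prod, Finset.prod_congr rfl (fun i _ => hNu i),
        Finset.prod_congr rfl (fun j _ => hNg j)]
      push_cast
      rfl
    rw [hNz, Rat.isSquare_intCast_iff] at hN
    exact hN
  · -- the place of the smallest conjugate: positive
    exact (even_card_iff_pos ρ₁ hw0 hg0 hsu₁ hsg₁ T U).mpr hρ1z
  · -- the two other places: equal signs
    rw [Nat.even_add, even_card_iff_pos ρ₂ hw0 hg0 hsu₂ hsg₂ T U,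
      even_card_iff_pos ρ₃ hw0 hg0 hsu₃ hsg₃ T U]
    exact pos_iff_pos_of_neg_iff_neg ((map_ne_zero ρ₂).mpr hz0) ((map_ne_zero ρ₃).mpr hz0) h23z

end Sieve

end Summit.BirchSwinnertonDyer.BirchSwinnertonDyer.Rank2Observatory.TwoDescCubic

end
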